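import Literature.AnabelianGeometry.SemiGraphs.PSCIrreducibleNodalShape
import HarnessLib

/-!
# [CombGC] Prop. 1.2 (i) at irreducible one-nodal data including the one-pointed nodal cubic: the conjugacy engine

Mochizuki, *A combinatorial version of the Grothendieck conjecture* [CombGC] §1, Prop. 1.2 (i) p. 8
[cite: MochizukiCombGC2007, Prop 1.2(i) p.8].  PROOF-ONLY sequel (abc-iut-f-164 gen 2; row F-0459) to
`PSCIrreducibleNodalShape.lean` (irreducible one-nodal shape: one vertex with a loop over a pro-`Σ`
completion `ι : Γ_{g,r} → Π`, node group `closure ι⟨b_0⟩`, cusp groups `closure ι⟨c_j⟩`), which needed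
`2 ≤ g ∨ 2 ≤ r`.  The excluded case was the ONE-POINTED NODAL CUBIC `Γ_{1,1}`: there
`c_0 = (a_0 b_0 a_0⁻¹ b_0⁻¹)⁻¹` lies in the normal closure of the node loop `b_0`, so every quotient KILLING
`Π_ν` kills `Π_{c_0}`, and the kernel engine cannot separate "cusp versus node".

## The conjugacy engine

Openness of `γ₁Π_{c}γ₁⁻¹ ∩ γ₂Π_νγ₂⁻¹` in the former puts a positive power `(γ₁ι(c_0)γ₁⁻¹)^m` INSIDE
`γ₂Π_νγ₂⁻¹` (`exists_pow_mem_of_isOpen_inf_subgroupOf`); a continuous `Ψ : Π → H` to a finite group maps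
`Π_ν = closure ι⟨b_0⟩` into the cyclic group `⟨Ψι(b_0)⟩`, so that power is conjugate INTO `⟨Ψι(b_0)⟩`.  In the
Heisenberg group `H = (ℤ/ℓⁿ × ℤ/ℓⁿ) ⋊ ℤ/ℓⁿ` with `a_0 ↦ X`, `b_0 ↦ Y`, `c_0 ↦ Z⁻¹ = [X,Y]⁻¹` (CENTRAL, so all
the conjugations disappear) this reads `Y^t = Z^{∓m}`; comparing first coordinates in `ℤ/ℓⁿ × ℤ/ℓⁿ`
(the shear action fixes them) gives `t ≡ 0`, so `Y^t = 1`, `Z^m = 1`, `ℓⁿ ∣ m` — impossible for `n = m`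
(`Heisenberg.exists_heisenbergTriple_conj`, `not_isOpen_inf_subgroupOf_of_heisenberg_conj`).  Results:
`edgeLikeOpenInterDeterminesEdge_of_irreducibleNodal'`, `openInterDeterminesComponent_of_irreducibleNodal'`
for EVERY hyperbolic irreducible one-nodal shape (`g ≥ 1`, `2 ≤ g ∨ 1 ≤ r`); origin forms and the
`Γ_{1,1}` inhabitant are in `PSCIrreducibleNodalConjOrigin.lean`.  Shape instances are consistency
evidence for the typed schema; nothing here takes a side on [IUTchIII] Cor. 3.12.
-/

noncomputable section

open Multiplicative

/-! ### The Heisenberg triple: no conjugate of a power of `Y` is a non-trivial power of `Z` -/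

namespace Literature.AnabelianGeometry.SemiGraphs.Heisenberg

open SemidirectProduct

/-- Conjugating `inl n` in a semidirect product with commutative kernel: `h · n · h⁻¹ = φ_{h.right}(n)`.
[cite: MochizukiSemiAnbd2006, Ex. 2.10 p.31] -/
theorem conj_inl_eq {N G : Type*} [CommGroup N] [Group G] {φ : G →* MulAut N} (h : N ⋊[φ] G) (n : N) :
    h * inl n * h⁻¹ = inl (φ h.right n) := by
  refine SemidirectProduct.ext ?_ ?_
  · rw [mul_left, mul_left, left_inl, inv_left, mul_right, right_inl, mul_one, ← MulAut.mul_apply,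
      ← map_mul, mul_inv_cancel, map_one, MulAut.one_apply, left_inl, mul_inv_cancel_comm]
  · rw [mul_right, mul_right, right_inl, mul_one, inv_right, mul_inv_cancel, right_inl]

/-- **Heisenberg triple, conjugacy form**: in `H_q = (ℤ/q × ℤ/q) ⋊_φ ℤ/q` the elements `X, Y, Z`
satisfy `X Y X⁻¹ Y⁻¹ = Z`, `Z` central, `|H_q| = q³`, and: if a conjugate of a power `Y^t` equals
`Z^m` or `Z^{-m}` then `q ∣ m` (first coordinates in `ℤ/q × ℤ/q`, on which the shear acts trivially,
give `t ≡ 0`, so `Y^t = 1` and `Z^m = 1`). [cite: MochizukiSemiAnbd2006, Ex. 2.10 p.31] -/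
theorem exists_heisenbergTriple_conj (q : ℕ) :
    ∃ (φ : Multiplicative (ZMod q) →* MulAut (Multiplicative (ZMod q × ZMod q)))
      (X Y Z : Multiplicative (ZMod q × ZMod q) ⋊[φ] Multiplicative (ZMod q)),
      X * Y * X⁻¹ * Y⁻¹ = Z ∧ Z ∈ Subgroup.center (Multiplicative (ZMod q × ZMod q) ⋊[φ] Multiplicative (ZMod q)) ∧
        (∀ (h : Multiplicative (ZMod q × ZMod q) ⋊[φ] Multiplicative (ZMod q)) (t : ℤ) (m : ℕ),
          (h * Y ^ t * h⁻¹ = Z ^ m ∨ h * Y ^ t * h⁻¹ = (Z ^ m)⁻¹) → q ∣ m) ∧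
        Nat.card (Multiplicative (ZMod q × ZMod q) ⋊[φ] Multiplicative (ZMod q)) = q ^ 3 := by
  obtain ⟨φ, hφ⟩ := exists_shearAction q
  have hZ : ∀ m : ℕ, (inl (ofAdd ((0 : ZMod q), (1 : ZMod q))) : Multiplicative (ZMod q × ZMod q) ⋊[φ] Multiplicative (ZMod q)) ^ m = 1 ↔ q ∣ m := by
    intro m
    rw [← map_pow, ← (inl : _ →* Multiplicative (ZMod q × ZMod q) ⋊[φ] Multiplicative (ZMod q)).map_one, inl_inj,
      ← ofAdd_nsmul, ← ofAdd_zero, ofAdd.apply_eq_iff_eq, Prod.smul_mk, smul_zero, nsmul_eq_mul,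
      mul_one, Prod.mk_eq_zero, eq_self_iff_true, true_and, ZMod.natCast_eq_zero_iff]
  refine ⟨φ, inr (ofAdd 1), inl (ofAdd (1, 0)), inl (ofAdd (0, 1)), ?_, ?_, fun h t m hE => ?_, ?_⟩
  · have h1 : (inr (ofAdd (1 : ZMod q)) : Multiplicative (ZMod q × ZMod q) ⋊[φ] Multiplicative (ZMod q)) *
        inl (ofAdd (1, 0)) * (inr (ofAdd 1))⁻¹ = inl (ofAdd (1, 1)) := by
      rw [← map_inv, ← inl_aut, hφ]
      simp
    rw [h1, ← map_inv, ← map_mul, inl_inj, ← ofAdd_neg, ← ofAdd_add]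
    simp
  · refine Subgroup.mem_center_iff.mpr fun w => SemidirectProduct.ext ?_ ?_
    · rw [mul_left, mul_left, left_inl, right_inl, map_one, MulAut.one_apply, hφ, mul_comm]
      simp
    · rw [mul_right, mul_right, right_inl, mul_one, one_mul]
  · -- the first coordinate of `φ_g v` is that of `v`
    have hfst : ∀ (g : Multiplicative (ZMod q)) (v : Multiplicative (ZMod q × ZMod q)),
        (toAdd (φ g v)).1 = (toAdd v).1 := fun g v => by rw [hφ]; rfl
    have hconj : h * (inl (ofAdd ((1 : ZMod q), (0 : ZMod q))) : Multiplicative (ZMod q × ZMod q) ⋊[φ] Multiplicative (ZMod q)) ^ t * h⁻¹ =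
        inl (φ h.right ((ofAdd ((1 : ZMod q), (0 : ZMod q))) ^ t)) := by
      rw [← map_zpow]; exact conj_inl_eq h _
    -- `t ≡ 0 (mod q)`
    have ht : ((t : ℤ) : ZMod q) = 0 := by
      have key : (toAdd (φ h.right ((ofAdd ((1 : ZMod q), (0 : ZMod q))) ^ t))).1 =
          (t : ZMod q) := by
        rw [hfst, ← ofAdd_zsmul, toAdd_ofAdd, Prod.smul_mk, smul_zero, zsmul_eq_mul, mul_one]
      rcases hE with hE | hE <;> rw [hconj] at hE
      · rw [← map_pow, inl_inj] at hE
        rw [← key, hE, ← ofAdd_nsmul, toAdd_ofAdd, Prod.smul_mk, smul_zero]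
      · rw [← map_pow, ← map_inv, inl_inj] at hE
        rw [← key, hE, ← ofAdd_nsmul, ← ofAdd_neg, toAdd_ofAdd, Prod.smul_mk, smul_zero, Prod.neg_mk,
          neg_zero]
    -- hence `Y ^ t = 1` and `Z ^ m = 1`
    have hY : (inl (ofAdd ((1 : ZMod q), (0 : ZMod q))) : Multiplicative (ZMod q × ZMod q) ⋊[φ] Multiplicative (ZMod q)) ^ t = 1 := by
      rw [← map_zpow, ← ofAdd_zsmul, Prod.smul_mk, smul_zero, zsmul_eq_mul, mul_one, ht,
        Prod.mk_zero_zero, ofAdd_zero, map_one]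
    rw [hY, mul_one, mul_inv_cancel] at hE
    rcases hE with hE | hE
    · exact (hZ m).mp hE.symm
    · exact (hZ m).mp (inv_eq_one.mp hE.symm)
  · rw [SemidirectProduct.card, Nat.card_congr (toAdd : Multiplicative (ZMod q × ZMod q) ≃ _),
      Nat.card_congr (toAdd : Multiplicative (ZMod q) ≃ _), Nat.card_prod, Nat.card_zmod]
    ring


end Literature.AnabelianGeometry.SemiGraphs.Heisenberg

namespace Literature.AnabelianGeometry.SemiGraphs

open scoped Pointwise
open Literature.GroupTheory.CombinatorialGroupTheory
open SemiGraphOfAnabelioids (IsProSigmaCompletion)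

universe u

namespace PSCDatum

open TwoComponentAffine

variable {P : Type u} [Group P] [TopologicalSpace P] [IsTopologicalGroup P]
variable [CompactSpace P] [T2Space P] [TotallyDisconnectedSpace P] {Sigma : Set ℕ} {g r : ℕ}

omit [T2Space P] in
/-- **The conjugacy engine.**  `γ₁ι(γ₀)γ₁⁻¹ ∈ S`; if for every `n` and every Heisenberg triple
`X, Y, Z` of `H = (ℤ/ℓⁿ × ℤ/ℓⁿ) ⋊ ℤ/ℓⁿ` some `ψ : Γ_{g,r} → H` has `ψ(γ₀) = Z^{±1}` and `ψ(z) = Y`, then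
`S ∩ γ₂·closure ι⟨z⟩·γ₂⁻¹` is not open in `S`: a power `m ≥ 1` of `γ₁ι(γ₀)γ₁⁻¹` would lie in
`γ₂·closure ι⟨z⟩·γ₂⁻¹`, and applying the continuous extension `Ψ` of `ψ` (which maps `closure ι⟨z⟩` into
`⟨Y⟩`, and under which the central `Z^{±m}` absorbs all conjugations) gives `Y^t = Z^{±m}`, i.e. `ℓ^m ∣ m`.
[cite: MochizukiCombGC2007, Prop 1.2(i) p.8] -/
theorem not_isOpen_inf_subgroupOf_of_heisenberg_conj {ι : PuncturedSurfaceGroup g r →* P}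
    (hι : IsProSigmaCompletion Sigma ι) {ℓ : ℕ} (hℓ : ℓ.Prime) (hℓS : ℓ ∈ Sigma) {S : Subgroup P}
    (γ₁ γ₂ : ConjAct P) (γ₀ z : PuncturedSurfaceGroup g r) (hx : γ₁ • ι γ₀ ∈ S)
    (h : ∀ (n : ℕ) (φ : Multiplicative (ZMod (ℓ ^ n)) →* MulAut (Multiplicative (ZMod (ℓ ^ n) × ZMod (ℓ ^ n))))
      (X Y Z : Multiplicative (ZMod (ℓ ^ n) × ZMod (ℓ ^ n)) ⋊[φ] Multiplicative (ZMod (ℓ ^ n))), X * Y * X⁻¹ * Y⁻¹ = Z → Z ∈ Subgroup.center (Multiplicative (ZMod (ℓ ^ n) × ZMod (ℓ ^ n)) ⋊[φ] Multiplicative (ZMod (ℓ ^ n))) →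
      ∃ ψ : PuncturedSurfaceGroup g r →* Multiplicative (ZMod (ℓ ^ n) × ZMod (ℓ ^ n)) ⋊[φ] Multiplicative (ZMod (ℓ ^ n)), (ψ γ₀ = Z ∨ ψ γ₀ = Z⁻¹) ∧ ψ z = Y) :
    ¬ IsOpen (((S ⊓ γ₂ • ((Subgroup.zpowers z).map ι).topologicalClosure).subgroupOf S : Subgroup S) :
      Set S) := by
  intro hopen
  obtain ⟨n, hn, hxn⟩ := exists_pow_mem_of_isOpen_inf_subgroupOf hx hopen
  obtain ⟨φ, X, Y, Z, hXY, hZc, hconj, hcard⟩ := Heisenberg.exists_heisenbergTriple_conj (ℓ ^ n)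
  obtain ⟨ψ, hψ, hz⟩ := h n φ X Y Z hXY hZc
  letI : TopologicalSpace (Multiplicative (ZMod (ℓ ^ n) × ZMod (ℓ ^ n)) ⋊[φ] Multiplicative (ZMod (ℓ ^ n))) := ⊥
  haveI : DiscreteTopology (Multiplicative (ZMod (ℓ ^ n) × ZMod (ℓ ^ n)) ⋊[φ] Multiplicative (ZMod (ℓ ^ n))) := ⟨rfl⟩
  haveI : Finite (Multiplicative (ZMod (ℓ ^ n) × ZMod (ℓ ^ n)) ⋊[φ] Multiplicative (ZMod (ℓ ^ n))) :=
    Nat.finite_of_card_ne_zero (by rw [hcard]; exact pow_ne_zero _ (pow_ne_zero _ hℓ.ne_zero))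
  obtain ⟨Ψ, hΨc, hΨ⟩ := hι.exists_continuous_extend_of_card_primePow hℓ hℓS (k := n * 3)
    (by rw [hcard, pow_mul]) ψ
  -- the closure of `ι⟨z⟩` maps into `⟨Y⟩`
  have hcl : ((Subgroup.zpowers z).map ι).topologicalClosure ≤ (Subgroup.zpowers Y).comap Ψ := by
    refine Subgroup.topologicalClosure_minimal _ (Subgroup.map_le_iff_le_comap.mpr
      ((Subgroup.zpowers_le).mpr ?_)) (by
        rw [Subgroup.coe_comap]; exact (isClosed_discrete _).preimage hΨc)
    simp only [Subgroup.mem_comap, hΨ, hz]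
    exact Subgroup.mem_zpowers Y
  obtain ⟨t, ht⟩ := Subgroup.mem_zpowers_iff.mp
    (hcl (Subgroup.mem_pointwise_smul_iff_inv_smul_mem.mp hxn))
  -- `Ψ` of the conjugated power is `ψ(γ₀)^n` (central)
  have hcent : ψ γ₀ ∈ Subgroup.center (Multiplicative (ZMod (ℓ ^ n) × ZMod (ℓ ^ n)) ⋊[φ] Multiplicative (ZMod (ℓ ^ n))) := by
    rcases hψ with hψ | hψ
    · rw [hψ]; exact hZc
    · rw [hψ]; exact Subgroup.inv_mem _ hZc
  have hcomm : ∀ w : Multiplicative (ZMod (ℓ ^ n) × ZMod (ℓ ^ n)) ⋊[φ] Multiplicative (ZMod (ℓ ^ n)), w * ψ γ₀ ^ n * w⁻¹ = ψ γ₀ ^ n := fun w =>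
    mul_inv_eq_iff_eq_mul.mpr (Subgroup.mem_center_iff.mp (Subgroup.pow_mem _ hcent n) w)
  have hval : Ψ (γ₂⁻¹ • (γ₁ • ι γ₀) ^ n) = ψ γ₀ ^ n := by
    simp only [ConjAct.smul_def, map_mul, map_inv, map_pow, hΨ, conj_pow, hcomm]
  rw [hval] at ht
  have hdvd : ℓ ^ n ∣ n := hconj 1 t n (by
    rw [one_mul, inv_one, mul_one, ht]
    rcases hψ with hψ | hψ
    · exact Or.inl (by rw [hψ])
    · exact Or.inr (by rw [hψ, inv_pow]))
  exact absurd (Nat.le_of_dvd hn hdvd) (not_le.mpr (Nat.lt_pow_self hℓ.one_lt))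

omit [CompactSpace P] [T2Space P] [TotallyDisconnectedSpace P] in
/-- A conjugate of a closed subgroup is closed (private copy of abc-iut-w5-d183's `isClosed_conj_smul`).
[cite: MochizukiCombGC2007, Def 1.1(ii) p.6] -/
private theorem isClosed_conj_smul₅ {A : Subgroup P} (hA : IsClosed (A : Set P)) (γ : ConjAct P) :
    IsClosed ((γ • A : Subgroup P) : Set P) := by
  have h : ((γ • A : Subgroup P) : Set P) = (fun x : P => γ⁻¹ • x) ⁻¹' (A : Set P) := by
    ext x
    rw [SetLike.mem_coe, Subgroup.mem_pointwise_smul_iff_inv_smul_mem]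
    rfl
  rw [h]
  refine hA.preimage ?_
  simp only [ConjAct.smul_def]
  fun_prop

/-! ### The edge-like case at every hyperbolic irreducible one-nodal shape -/

/-- **[CombGC] Prop. 1.2 (i), edge-like case, at irreducible one-nodal shape — including `Γ_{1,1}`**
(`g ≥ 1`, `2 ≤ g ∨ 1 ≤ r`): node/node — one node; cusp/cusp — malnormality; node/cusp — the handle
character `b_0 ↦ 1`; cusp/node — the two-cusp character when `r ≥ 2`, and for `r = 1` the CONJUGACY
engine with `(a_0, b_0) ↦ (X, Y)`, `c_0 ↦ Z⁻¹`. [cite: MochizukiCombGC2007, Prop 1.2(i) p.8] -/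
theorem edgeLikeOpenInterDeterminesEdge_of_irreducibleNodal' (hne : Sigma.Nonempty)
    (hprime : ∀ p ∈ Sigma, p.Prime) (ι : PuncturedSurfaceGroup g r →* P)
    (hι : IsProSigmaCompletion Sigma ι) (G : PSCDatum P) (hg : 1 ≤ g) (hgr : 2 ≤ g ∨ 1 ≤ r)
    (e : G.graph.C ≃ Fin r)
    (hC : ∀ c, G.cuspGp c =
      ((PuncturedSurfaceGroup.cuspInertia (g := g) (e c)).map ι).topologicalClosure)
    (n₀ : G.graph.N) (hN : ∀ n, n = n₀)
    (hE : G.nodeGp n₀ =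
      ((Subgroup.zpowers (PuncturedSurfaceGroup.b (r := r) (⟨0, hg⟩ : Fin g))).map ι).topologicalClosure) :
    G.EdgeLikeOpenInterDeterminesEdge := by
  classical
  by_cases h2 : 2 ≤ g ∨ 2 ≤ r
  · exact G.edgeLikeOpenInterDeterminesEdge_of_irreducibleNodal hne hprime ι hι hg h2 e hC n₀ hN hE
  -- `g = 1`, `r = 1`
  have hg1 : g = 1 := by omega
  have hr1 : r = 1 := by omega
  have hne' := hne
  obtain ⟨ℓ, hℓS⟩ := hne
  have hℓ : ℓ.Prime := hprime ℓ hℓS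
  have hhyp : PuncturedSurfaceGroup.IsHyperbolicType g r := by
    unfold PuncturedSurfaceGroup.IsHyperbolicType; omega
  intro e₁ e₂ γ₁ γ₂ hopen
  by_contra hne12
  rcases e₁ with n₁ | c₁ <;> rcases e₂ with n₂ | c₂
  · exact hne12 (by rw [hN n₁, hN n₂])
  · -- node vs cusp: the handle character `b_0 ↦ 1`
    have hopen' := hopen
    change IsOpen ((((γ₁ • G.nodeGp n₁) ⊓ γ₂ • G.cuspGp c₂).subgroupOf (γ₁ • G.nodeGp n₁) :
      Subgroup (γ₁ • G.nodeGp n₁ : Subgroup P)) : Set (γ₁ • G.nodeGp n₁ : Subgroup P)) at hopen'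
    rw [hN n₁, hE, hC, PuncturedSurfaceGroup.cuspInertia] at hopen'
    refine not_isOpen_inf_subgroupOf_of_characters hℓ.one_lt _ _
      (x := γ₁ • ι (PuncturedSurfaceGroup.b (r := r) (⟨0, hg⟩ : Fin g)))
      (Subgroup.smul_mem_pointwise_smul _ _ _ (Subgroup.le_topologicalClosure _
        (Subgroup.mem_map_of_mem ι (Subgroup.mem_zpowers _)))) (fun n => ?_) hopen'
    let wb : Fin g → ZMod (ℓ ^ n) := fun i => if i = ⟨0, hg⟩ then 1 else 0
    obtain ⟨φ, -, hφb, hφc⟩ :=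
      PuncturedSurfaceGroup.exists_handleCuspCharacter (r := r) 0 wb 0 (by simp)
    obtain ⟨χ, hχc, hχ⟩ := exists_continuous_extend_zmod_pow hι hℓ hℓS n φ
    refine ⟨χ, smul_le_ker_of_le_ker (topologicalClosure_map_zpowers_le_ker ι χ hχc _ ?_) γ₂,
      by rw [map_conjAct_smul_eq_self, hχ, hφb]; simp [wb]⟩
    rw [hχ, hφc]; rfl
  · -- cusp vs node (`r = 1`): the conjugacy engine
    have hopen' := hopen
    change IsOpen ((((γ₁ • G.cuspGp c₁) ⊓ γ₂ • G.nodeGp n₂).subgroupOf (γ₁ • G.cuspGp c₁) :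
      Subgroup (γ₁ • G.cuspGp c₁ : Subgroup P)) : Set (γ₁ • G.cuspGp c₁ : Subgroup P)) at hopen'
    rw [hN n₂, hE] at hopen'
    refine not_isOpen_inf_subgroupOf_of_heisenberg_conj hι hℓ hℓS γ₁ γ₂
      (PuncturedSurfaceGroup.c (e c₁)) (PuncturedSurfaceGroup.b (r := r) (⟨0, hg⟩ : Fin g)) ?_
      (fun n φ X Y Z hXY _ => ?_) hopen'
    · rw [hC]
      exact Subgroup.smul_mem_pointwise_smul _ _ _ (Subgroup.le_topologicalClosure _
        (Subgroup.mem_map_of_mem ι (Subgroup.mem_zpowers _)))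
    · have hrel : X * Y * X⁻¹ * Y⁻¹ * Z⁻¹ = 1 := by rw [hXY, mul_inv_cancel]
      obtain ⟨ψ, -, hb, hc, -, -⟩ := PuncturedSurfaceGroup.exists_hom_handle_cusp
        (g := g) (r := r) ⟨0, hg⟩ (e c₁) X Y Z⁻¹ hrel
      exact ⟨ψ, Or.inr hc, hb⟩
  · -- cusp vs cusp: one cusp
    have hsub : Subsingleton (Fin r) := by rw [hr1]; infer_instance
    exact hne12 (by rw [e.injective (hsub.elim (e c₁) (e c₂))])

/-- **[CombGC] Prop. 1.2 (i) — all three cases — at every hyperbolic irreducible one-nodal datum**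
(`g ≥ 1`, `2 ≤ g ∨ 1 ≤ r`; one vertex, so the verticial and unramified cases are trivial).
[cite: MochizukiCombGC2007, Prop 1.2(i) p.8] -/
theorem openInterDeterminesComponent_of_irreducibleNodal' (hne : Sigma.Nonempty)
    (hprime : ∀ p ∈ Sigma, p.Prime) (ι : PuncturedSurfaceGroup g r →* P)
    (hι : IsProSigmaCompletion Sigma ι) (G : PSCDatum P) (hg : 1 ≤ g) (hgr : 2 ≤ g ∨ 1 ≤ r)
    (e : G.graph.C ≃ Fin r)
    (hC : ∀ c, G.cuspGp c =
      ((PuncturedSurfaceGroup.cuspInertia (g := g) (e c)).map ι).topologicalClosure)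
    (v₀ : G.graph.V) (hV : ∀ w, w = v₀) (n₀ : G.graph.N) (hN : ∀ n, n = n₀)
    (hE : G.nodeGp n₀ =
      ((Subgroup.zpowers (PuncturedSurfaceGroup.b (r := r) (⟨0, hg⟩ : Fin g))).map ι).topologicalClosure) :
    G.VerticialOpenInterDeterminesVertex ∧ G.EdgeLikeOpenInterDeterminesEdge ∧
      G.UnrVerticialOpenInterDeterminesVertex :=
  ⟨G.verticialOpenInterDeterminesVertex_of_subsingleton v₀ hV,
    G.edgeLikeOpenInterDeterminesEdge_of_irreducibleNodal' hne hprime ι hι hg hgr e hC n₀ hN hE,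
    G.unrVerticialOpenInterDeterminesVertex_of_subsingleton v₀ hV⟩

end PSCDatum

end Literature.AnabelianGeometry.SemiGraphs

end
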